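import Literature.Analysis.FluidPDE.SereginLocalStokesRegularity
import Literature.Analysis.FluidPDE.SereginSverakBlowup
import Mathlib.Analysis.MeanInequalitiesPow
import HarnessLib

/-!
# Tools for the assembly of the Seregin–Šverák local Hölder bound

Analysis/FluidPDE support file on the decomposition path of the named fact
`Literature.Analysis.FluidPDE.SereginSverak2009.LocalHolderBound`
(`FluidPDE/SereginSverakBlowup`; Seregin–Šverák 2009, §4, arXiv:0804.1803 p. 11), which is
assembled in `FluidPDE/SereginSverakLocalHolderProofs` from the three linear facts of
`FluidPDE/SereginLocalStokesRegularity` (`HeatDivSourceGradientBound`,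
`StokesLocalIntegrabilityGain`, `StokesLocalHolderBound`). Everything here is elementary and
proved:

* volumes of the ball-based cylinders `Q(z, R) = ]t - R², t[ × B(x, R)` of `ℝ × ℝ³` and the
  bookkeeping of the mixed norms `mixedNorm s n z R` of that file: Tonelli for `s = n`
  (`mixedNorm_self_eq`), constants and essentially bounded functions (`mixedNorm_const`,
  `mixedNorm_le_of_ae_le`, `mixedNorm_const_lt_top`), integrability from a finite `L_s` norm
  (`integrableOn_of_mixedNorm_lt_top`);
* integrability of test-weighted integrands (`integrableOn_inner_of_tsupport_subset`,
  `integrableOn_mul_of_tsupport_subset`);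
* the matrix field `F = u ⊗ u + p 𝕀` of §4 as a field of linear maps (`ssTensor`), its operator
  norm bound `|F| ≤ |u|² + |p|`, its local integrability for a distributional Navier–Stokes pair,
  and the **heat form of the Navier–Stokes identity**
  (`heatForm_of_isDistributionalNSSolutionOn`: `∑ⱼ ⟪F eⱼ, ∂ⱼψ⟫ = ⟪u, (u·∇)ψ⟫ + p div ψ`
  pointwise, so "`u` satisfies `∂ₜu - Δu = -div F`", SS2009 p. 11);
* the inclusions between the Seregin–Šverák cylinders `𝒞(R) × ]-R², 0[` (`parCyl`) and the
  ball-based ones (`parabolicCylinder_origin_subset_parCyl`,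
  `parCyl_half_subset_parabolicCylinder`);
* the passage from a parabolic Hölder modulus `(|x - x'| + |t - t'|^{1/2})^μ` on a bounded set to
  Mathlib's `HolderOnWith` for the max product metric with exponent `μ/2`
  (`holderOnWith_of_parabolic`), as announced in the docstring of `LocalHolderBound`.

## References

* G. Seregin, V. Šverák, Comm. PDE 34 (2009) = arXiv:0804.1803, §4 p. 11. [`SereginSverak2009`]
* G. Seregin, *Lecture notes on regularity theory for the Navier–Stokes equations* (2014), §4.4,
  §4.6, §6.5. [`Seregin2014`]
-/

noncomputable section

open MeasureTheory TopologicalSpace Set Function Metric Filter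
open scoped Laplacian InnerProductSpace RealInnerProductSpace ENNReal NNReal Topology

namespace Literature.Analysis.FluidPDE
/-! ## Tools for the assembly of `SereginSverak2009.LocalHolderBound` -/

section Tools

/-- Local notation for physical space `ℝ³ = EuclideanSpace ℝ (Fin 3)`. -/
local notation "ℝ³" => EuclideanSpace ℝ (Fin 3)

/-! ### Volumes and mixed norms on the cylinders of `ℝ × ℝ³` -/

/-- A backward parabolic cylinder of `ℝ × ℝ³` has finite measure. [folklore] -/
theorem parabolicCylinder_volume_lt_top (r : ℝ) (z : ℝ × ℝ³) :
    volume (parabolicCylinder r z) < ∞ := by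
  rw [show parabolicCylinder r z = Ioo (z.1 - r ^ 2) z.1 ×ˢ ball z.2 r from rfl,
    Measure.volume_eq_prod, Measure.prod_prod]
  exact ENNReal.mul_lt_top measure_Ioo_lt_top measure_ball_lt_top

/-- The restriction of Lebesgue measure to a backward parabolic cylinder is finite (a lemma, not
an instance; use with `haveI`). [folklore] -/
theorem isFiniteMeasure_restrict_parabolicCylinder (r : ℝ) (z : ℝ × ℝ³) :
    IsFiniteMeasure (volume.restrict (parabolicCylinder r z)) :=
  isFiniteMeasure_restrict.2 (parabolicCylinder_volume_lt_top r z).ne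

/-- **Tonelli for mixed norms**: for equal exponents `s = n` the mixed norm is the `L_s` norm on
the cylinder, `‖F‖_{s,s,Q(z,R)} = (∫∫_{Q(z,R)} |F|ˢ)^{1/s}`. [folklore] -/
theorem mixedNorm_self_eq {α : Type*} [ENorm α] {s : ℝ} (hs : 0 < s) (z : ℝ × ℝ³) (R : ℝ)
    {F : ℝ × ℝ³ → α}
    (hF : AEMeasurable (fun w => ‖F w‖ₑ) (volume.restrict (parabolicCylinder R z))) :
    mixedNorm s s z R F = (∫⁻ w in parabolicCylinder R z, ‖F w‖ₑ ^ s) ^ (1 / s) := by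
  unfold mixedNorm
  rw [div_self hs.ne']
  simp only [ENNReal.rpow_one]
  congr 1
  rw [show parabolicCylinder R z = Ioo (z.1 - R ^ 2) z.1 ×ˢ ball z.2 R from rfl,
    Measure.volume_eq_prod, ← Measure.prod_restrict] at hF ⊢
  rw [lintegral_prod _ (hF.pow_const s)]

/-- The mixed norm of a constant. [folklore] -/
theorem mixedNorm_const {s n : ℝ} (z : ℝ × ℝ³) (R : ℝ) (c : ℝ≥0∞) :
    mixedNorm s n z R (fun _ : ℝ × ℝ³ => c) =
      ((c ^ s * volume (ball z.2 R)) ^ (n / s) * volume (Ioo (z.1 - R ^ 2) z.1)) ^ (1 / n) := by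
  simp [mixedNorm]

/-- An essentially bounded function has mixed norm at most that of the bounding constant.
[folklore] -/
theorem mixedNorm_le_of_ae_le {α : Type*} [ENorm α] {s n : ℝ} (hs : 0 ≤ s) (hn : 0 < n)
    {z : ℝ × ℝ³} {R : ℝ} {F : ℝ × ℝ³ → α} {c : ℝ≥0∞}
    (h : ∀ᵐ w ∂(volume.restrict (parabolicCylinder R z)), ‖F w‖ₑ ≤ c) :
    mixedNorm s n z R F ≤
      ((c ^ s * volume (ball z.2 R)) ^ (n / s) * volume (Ioo (z.1 - R ^ 2) z.1)) ^ (1 / n) := by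
  rw [← mixedNorm_const z R c]
  exact mixedNorm_mono_ae hs hn (by simpa using h)

/-- The bounding constant of `mixedNorm_le_of_ae_le` is finite. [folklore] -/
theorem mixedNorm_const_lt_top {s n : ℝ} (hs : 0 ≤ s) (hn : 0 < n) (z : ℝ × ℝ³) (R : ℝ)
    {c : ℝ≥0∞} (hc : c ≠ ∞) :
    ((c ^ s * volume (ball z.2 R)) ^ (n / s) * volume (Ioo (z.1 - R ^ 2) z.1)) ^ (1 / n) < ∞ := by
  refine ENNReal.rpow_lt_top_of_nonneg (by positivity) (ENNReal.mul_lt_top ?_ measure_Ioo_lt_top).ne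
  exact ENNReal.rpow_lt_top_of_nonneg (by positivity)
    (ENNReal.mul_lt_top (ENNReal.rpow_lt_top_of_nonneg hs hc) measure_ball_lt_top).ne

/-- A function with finite `L_s` mixed norm (`s ≥ 1`) on a cylinder is integrable there (the
cylinder has finite measure). [folklore] -/
theorem integrableOn_of_mixedNorm_lt_top {F' : Type*} [NormedAddCommGroup F'] {s : ℝ} (hs : 1 ≤ s)
    {z : ℝ × ℝ³} {R : ℝ} {F : ℝ × ℝ³ → F'}
    (hFm : AEStronglyMeasurable F (volume.restrict (parabolicCylinder R z)))
    (h : mixedNorm s s z R F < ∞) : IntegrableOn F (parabolicCylinder R z) volume := by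
  have hs0 : 0 < s := by linarith
  rw [mixedNorm_self_eq hs0 z R hFm.enorm] at h
  have hp0 : ENNReal.ofReal s ≠ 0 := (ENNReal.ofReal_pos.2 hs0).ne'
  haveI := isFiniteMeasure_restrict_parabolicCylinder R z
  have hmem : MemLp F (ENNReal.ofReal s) (volume.restrict (parabolicCylinder R z)) := by
    refine ⟨hFm, ?_⟩
    rw [eLpNorm_eq_lintegral_rpow_enorm_toReal hp0 ENNReal.ofReal_ne_top, ENNReal.toReal_ofReal hs0.le]
    exact h
  exact memLp_one_iff_integrable.1 (hmem.mono_exponent (ENNReal.one_le_ofReal.2 hs))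

/-! ### Integrability of test-weighted integrands -/

/-- A locally integrable field paired with a continuous compactly supported field whose support
lies in the open set is integrable there. [folklore] -/
theorem integrableOn_inner_of_tsupport_subset {G' : Type*} [NormedAddCommGroup G']
    [InnerProductSpace ℝ G'] {Q : Opens (ℝ × ℝ³)} {v Ψ : ℝ × ℝ³ → G'}
    (hv : LocallyIntegrableOn v (Q : Set (ℝ × ℝ³)) volume) (hΨ : Continuous Ψ)
    (hΨc : HasCompactSupport Ψ) (hΨQ : tsupport Ψ ⊆ (Q : Set (ℝ × ℝ³))) :
    IntegrableOn (fun w => ⟪v w, Ψ w⟫) (Q : Set (ℝ × ℝ³)) volume := by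
  have hK : IsCompact (tsupport Ψ) := hΨc
  have hvK : IntegrableOn v (tsupport Ψ) volume := hv.integrableOn_compact_subset hΨQ hK
  obtain ⟨M, hM⟩ := hΨ.bounded_above_of_compact_support hΨc
  have hsupp : support (fun w => ⟪v w, Ψ w⟫) ⊆ tsupport Ψ := by
    intro w hw
    by_contra hwK
    exact hw (by simp [image_eq_zero_of_notMem_tsupport hwK])
  refine ((integrableOn_iff_integrable_of_support_subset hsupp).1 ?_).integrableOn
  refine Integrable.mono' (hvK.norm.mul_const M)
    (hvK.aestronglyMeasurable.inner hΨ.aestronglyMeasurable) ?_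
  filter_upwards with w
  exact (norm_inner_le_norm _ _).trans (mul_le_mul_of_nonneg_left (hM w) (norm_nonneg _))

/-- A locally integrable scalar multiplied by a continuous compactly supported scalar whose
support lies in the open set is integrable there. [folklore] -/
theorem integrableOn_mul_of_tsupport_subset {Q : Opens (ℝ × ℝ³)} {q θ : ℝ × ℝ³ → ℝ}
    (hq : LocallyIntegrableOn q (Q : Set (ℝ × ℝ³)) volume) (hθ : Continuous θ)
    (hθc : HasCompactSupport θ) (hθQ : tsupport θ ⊆ (Q : Set (ℝ × ℝ³))) :
    IntegrableOn (fun w => q w * θ w) (Q : Set (ℝ × ℝ³)) volume := by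
  have h := integrableOn_inner_of_tsupport_subset (G' := ℝ) hq hθ hθc hθQ
  simpa only [RCLike.inner_apply, conj_trivial, mul_comm] using h

end Tools

section Tools2

/-- Local notation for physical space `ℝ³ = EuclideanSpace ℝ (Fin 3)`. -/
local notation "ℝ³" => EuclideanSpace ℝ (Fin 3)

/-! ### The tensor `u ⊗ u + p 𝕀` and the heat form of the Navier–Stokes identity -/

/-- The matrix field `u ⊗ u + p 𝕀` of Seregin–Šverák 2009, §4 (`F^k = u^k ⊗ u^k + p^k 𝕀`), as
the linear map `v ↦ ⟪u, v⟫ u + p v`. [cite: SereginSverak2009, §4 p. 11] -/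
def ssTensor (u : ℝ³) (p : ℝ) : ℝ³ →L[ℝ] ℝ³ :=
  (innerSL ℝ u).smulRight u + p • ContinuousLinearMap.id ℝ ℝ³

/-- `(u ⊗ u + p 𝕀) v = ⟪u, v⟫ u + p v`. [folklore] -/
@[simp]
theorem ssTensor_apply (u v : ℝ³) (p : ℝ) : ssTensor u p v = ⟪u, v⟫ • u + p • v := by
  simp [ssTensor]

/-- Operator-norm bound `‖u ⊗ u + p 𝕀‖ ≤ |u|² + |p|`. [folklore] -/
theorem norm_ssTensor_le (u : ℝ³) (p : ℝ) : ‖ssTensor u p‖ ≤ ‖u‖ ^ 2 + |p| := by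
  refine ContinuousLinearMap.opNorm_le_bound _ (by positivity) fun v => ?_
  rw [ssTensor_apply]
  calc ‖⟪u, v⟫ • u + p • v‖ ≤ ‖⟪u, v⟫ • u‖ + ‖p • v‖ := norm_add_le _ _
    _ ≤ ‖u‖ * ‖v‖ * ‖u‖ + |p| * ‖v‖ := by
        rw [norm_smul, norm_smul, Real.norm_eq_abs, Real.norm_eq_abs]
        gcongr
        exact abs_real_inner_le_norm u v
    _ = (‖u‖ ^ 2 + |p|) * ‖v‖ := by ring

/-- The tensor depends continuously on `(u, p)`. [folklore] -/
theorem continuous_ssTensor : Continuous fun q : ℝ³ × ℝ => ssTensor q.1 q.2 := by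
  unfold ssTensor
  refine Continuous.add ?_ (continuous_snd.smul continuous_const)
  have h1 : Continuous fun q : ℝ³ × ℝ => ((innerSL ℝ q.1 : ℝ³ →L[ℝ] ℝ), q.1) :=
    ((innerSL ℝ).continuous.comp continuous_fst).prodMk continuous_fst
  exact (isBoundedBilinearMap_smulRight (𝕜 := ℝ) (E := ℝ³) (F := ℝ³)).continuous.comp h1

/-- The pairing of `u ⊗ u + p 𝕀` with a linear map `L` through an orthonormal basis:
`∑ⱼ ⟪(u ⊗ u + p 𝕀) bⱼ, L bⱼ⟫ = ⟪u, L u⟫ + p ∑ⱼ ⟪bⱼ, L bⱼ⟫` (= `u ⊗ u : L + p tr L`). [folklore] -/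
theorem sum_inner_ssTensor_apply {ι : Type*} [Fintype ι] (b : OrthonormalBasis ι ℝ ℝ³) (u : ℝ³)
    (p : ℝ) (L : ℝ³ →L[ℝ] ℝ³) :
    ∑ j, ⟪ssTensor u p (b j), L (b j)⟫ = ⟪u, L u⟫ + p * ∑ j, ⟪b j, L (b j)⟫ := by
  simp only [ssTensor_apply, inner_add_left, inner_smul_left, RCLike.conj_to_real,
    Finset.sum_add_distrib, ← Finset.mul_sum]
  congr 1
  have hu : L u = ∑ j, ⟪b j, u⟫ • L (b j) := by
    conv_lhs => rw [← b.sum_repr' u]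
    simp [map_sum, map_smul]
  rw [hu, inner_sum]
  refine Finset.sum_congr rfl fun j _ => ?_
  rw [inner_smul_right, real_inner_comm]

/-- The same pairing through the standard basis `eⱼ = EuclideanSpace.single j 1`. [folklore] -/
theorem sum_inner_ssTensor_single (u : ℝ³) (p : ℝ) (L : ℝ³ →L[ℝ] ℝ³) :
    ∑ j, ⟪ssTensor u p (EuclideanSpace.single j (1 : ℝ)), L (EuclideanSpace.single j (1 : ℝ))⟫ =
      ⟪u, L u⟫ + p * ∑ j, ⟪EuclideanSpace.single j (1 : ℝ), L (EuclideanSpace.single j (1 : ℝ))⟫ := by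
  have h := sum_inner_ssTensor_apply (EuclideanSpace.basisFun (Fin 3) ℝ) u p L
  simpa only [EuclideanSpace.basisFun_apply] using h

/-- The divergence through the standard basis: `div ψ = ∑ⱼ ⟪eⱼ, Dψ eⱼ⟫`. [folklore] -/
theorem divergence_eq_sum_inner_single (v : ℝ³ → ℝ³) (x : ℝ³) :
    VectorCalculus.divergence v x =
      ∑ j, ⟪EuclideanSpace.single j (1 : ℝ), fderiv ℝ v x (EuclideanSpace.single j (1 : ℝ))⟫ := by
  have h := divergence_eq_sum_inner_fderiv (EuclideanSpace.basisFun (Fin 3) ℝ) v x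
  simpa only [EuclideanSpace.basisFun_apply] using h

/-- **The Navier–Stokes identity in heat form.** A distributional Navier–Stokes solution
(`ν = 1`, no force) satisfies `∂ₜu - Δu = -div F` with `F = u ⊗ u + p 𝕀` in the sense of
distributions: `∫∫ (⟪u, ∂ₜψ⟫ + ⟪u, Δψ⟫ + ∑ⱼ ⟪F eⱼ, ∂ⱼψ⟫) = 0`, the integrand being pointwise
the Navier–Stokes one (`∑ⱼ ⟪F eⱼ, ∂ⱼψ⟫ = ⟪u, (u·∇)ψ⟫ + p div ψ`).
[cite: SereginSverak2009, §4 p. 11 ("u^k satisfies the nonhomogeneous heat equation … F^k = u^k ⊗ u^k + p^k 𝕀")] -/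
theorem heatForm_of_isDistributionalNSSolutionOn {Q : Opens (ℝ × ℝ³)} {u : ℝ → ℝ³ → ℝ³}
    {p : ℝ → ℝ³ → ℝ} (hNS : IsDistributionalNSSolutionOn Q 1 0 u p) {ψ : ℝ → ℝ³ → ℝ³}
    (hψ : IsSpaceTimeTestOn Q ψ) :
    ∫ w in (Q : Set (ℝ × ℝ³)), (⟪u w.1 w.2, timeDeriv ψ w.1 w.2⟫ + ⟪u w.1 w.2, Δ (ψ w.1) w.2⟫ +
      ∑ j, ⟪ssTensor (u w.1 w.2) (p w.1 w.2) (EuclideanSpace.single j (1 : ℝ)),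
        fderiv ℝ (ψ w.1) w.2 (EuclideanSpace.single j (1 : ℝ))⟫) = 0 := by
  rw [← hNS.2.2.2.2 ψ hψ]
  refine setIntegral_congr_fun Q.isOpen.measurableSet fun w _ => ?_
  rw [sum_inner_ssTensor_single, ← divergence_eq_sum_inner_single, convect_apply]
  simp only [Pi.zero_apply, inner_zero_left, add_zero, one_mul]
  ring

/-- The tensor field `F = u ⊗ u + p 𝕀` of a distributional Navier–Stokes solution is locally
integrable on the region (`|F| ≤ |u|² + |p|`). [folklore] -/
theorem locallyIntegrableOn_ssTensor {Q : Opens (ℝ × ℝ³)} {ν : ℝ} {f u : ℝ → ℝ³ → ℝ³}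
    {p : ℝ → ℝ³ → ℝ} (hNS : IsDistributionalNSSolutionOn Q ν f u p) :
    LocallyIntegrableOn (fun w : ℝ × ℝ³ => ssTensor (u w.1 w.2) (p w.1 w.2)) (Q : Set (ℝ × ℝ³))
      volume := by
  refine (locallyIntegrableOn_iff Q.isOpen.isLocallyClosed).2 fun K hKQ hK => ?_
  have hu2 : IntegrableOn (fun z => ‖uncurry u z‖ ^ 2) K volume :=
    hNS.2.1.integrableOn_compact_subset hKQ hK
  have hp : IntegrableOn (uncurry p) K volume := hNS.2.2.1.integrableOn_compact_subset hKQ hK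
  have hu : IntegrableOn (uncurry u) K volume := hNS.1.integrableOn_compact_subset hKQ hK
  have hpair : AEStronglyMeasurable (fun w : ℝ × ℝ³ => (uncurry u w, uncurry p w))
      (volume.restrict K) :=
    hu.aestronglyMeasurable.prodMk hp.aestronglyMeasurable
  have hmeas : AEStronglyMeasurable (fun w : ℝ × ℝ³ => ssTensor (u w.1 w.2) (p w.1 w.2))
      (volume.restrict K) :=
    (continuous_ssTensor.comp_aestronglyMeasurable hpair :)
  have hbound : Integrable (fun z => ‖uncurry u z‖ ^ 2 + ‖uncurry p z‖) (volume.restrict K) :=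
    Integrable.add hu2 hp.norm
  refine Integrable.mono' hbound hmeas ?_
  filter_upwards with w
  have h := norm_ssTensor_le (u w.1 w.2) (p w.1 w.2)
  have e1 : ‖uncurry u w‖ = ‖u w.1 w.2‖ := rfl
  have e2 : ‖uncurry p w‖ = |p w.1 w.2| := Real.norm_eq_abs _
  rw [e1, e2]
  exact h

/-- Pointwise bound `‖F‖ₑ ≤ ‖u‖ₑ² + ‖p‖ₑ` in `ℝ≥0∞`. [folklore] -/
theorem enorm_ssTensor_le (u : ℝ³) (p : ℝ) : ‖ssTensor u p‖ₑ ≤ ‖u‖ₑ ^ 2 + ‖p‖ₑ := by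
  have h := norm_ssTensor_le u p
  rw [← ofReal_norm, ← ofReal_norm, ← ofReal_norm,
    ← ENNReal.ofReal_pow (norm_nonneg _), Real.norm_eq_abs,
    ← ENNReal.ofReal_add (by positivity) (abs_nonneg _)]
  exact ENNReal.ofReal_le_ofReal h

/-! ### Cylinders: `Q(4a)_ball ⊆ Q(4a)_𝒞` and `Q(a/2)_𝒞 ⊆ Q(a)_ball` -/

/-- `‖x‖² = |x'|² + x₃²` in `ℝ³` (private copy of
`SereginSverak2009.norm_sq_eq_cylRadius_sq_add` of `FluidPDE/SereginSverakBlowupSelection`, to keep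
the import closure small). [folklore] -/
private theorem norm_sq_eq_cylRadius_sq_add_sq (x : ℝ³) : ‖x‖ ^ 2 = cylRadius x ^ 2 + x 2 ^ 2 := by
  rw [EuclideanSpace.norm_eq, Real.sq_sqrt (by positivity), cylRadius_sq]
  simp [Fin.sum_univ_three, sq_abs]

/-- The ball-based cylinder lies in the Seregin–Šverák cylinder of the same radius centred at
the origin: `]−R², 0[ × B(0, R) ⊆ 𝒞(R) × ]−R², 0[` (`|x'|, |x₃| ≤ |x|`); the origin case of
`parabolicCylinder_subset_parCyl` of `FluidPDE/SereginSverakPressureDecayBalls`, reproved here to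
keep the import closure of the assembly small. [folklore] -/
theorem parabolicCylinder_origin_subset_parCyl (R : ℝ) :
    parabolicCylinder R ((0 : ℝ), (0 : ℝ³)) ⊆ SereginSverak2009.parCyl 0 R := by
  intro z hz
  rw [mem_parabolicCylinder] at hz
  rw [SereginSverak2009.mem_parCyl_zero]
  have hn : ‖z.2‖ < R := by simpa using hz.2
  have h0 : 0 ≤ cylRadius z.2 := cylRadius_nonneg _
  have hsq := norm_sq_eq_cylRadius_sq_add_sq z.2
  have hR : 0 < R := (norm_nonneg _).trans_lt hn
  refine ⟨by simpa using hz.1, ?_, ?_⟩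
  · nlinarith [sq_nonneg (z.2 2), norm_nonneg z.2]
  · rw [abs_lt]
    constructor <;> nlinarith [norm_nonneg z.2, sq_nonneg (cylRadius z.2)]

/-- For `a > 0`, the Seregin–Šverák cylinder `Q(a/2) = 𝒞(a/2) × ]−a²/4, 0[` lies in the ball-based
cylinder `]−a², 0[ × B(0, a)` (`|x|² = |x'|² + x₃² < a²/2`; cf. `parCyl_subset_parabolicCylinder`
of `FluidPDE/SereginSverakPressureDecayBalls`, radius `√2 · a/2`). [folklore] -/
theorem parCyl_half_subset_parabolicCylinder {a : ℝ} (ha : 0 < a) :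
    SereginSverak2009.parCyl 0 (a / 2) ⊆ parabolicCylinder a ((0 : ℝ), (0 : ℝ³)) := by
  intro z hz
  rw [SereginSverak2009.mem_parCyl_zero] at hz
  rw [mem_parabolicCylinder]
  obtain ⟨⟨ht1, ht2⟩, hr, h3⟩ := hz
  refine ⟨⟨by nlinarith, by simpa using ht2⟩, ?_⟩
  rw [dist_zero_right]
  have h0 : 0 ≤ cylRadius z.2 := cylRadius_nonneg _
  have hsq := norm_sq_eq_cylRadius_sq_add_sq z.2
  have h3' := abs_lt.1 h3
  have hlt : ‖z.2‖ ^ 2 < a ^ 2 := by nlinarith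
  exact lt_of_pow_lt_pow_left₀ 2 ha.le hlt

/-! ### From a parabolic Hölder modulus to `HolderOnWith` for the max metric -/

/-- On a set of diameter `≤ D`, a parabolic Hölder bound
`‖V z₁ - V z₂‖ ≤ K (|x₁ - x₂| + |t₁ - t₂|^{1/2})^μ` gives the Hölder bound
`‖V z₁ - V z₂‖ ≤ K (√D + 1)^μ d(z₁,z₂)^{μ/2}` for the max product metric of `ℝ × ℝ³`
(`|x₁ - x₂| ≤ d = d^{1/2} d^{1/2} ≤ √D d^{1/2}`, `|t₁ - t₂|^{1/2} ≤ d^{1/2}`). [folklore] -/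
theorem holderOnWith_of_parabolic {S : Set (ℝ × ℝ³)} {V : ℝ × ℝ³ → ℝ³} {K : ℝ≥0} {μ D : ℝ}
    (hμ : 0 < μ) (hdiam : ∀ z₁ ∈ S, ∀ z₂ ∈ S, dist z₁ z₂ ≤ D)
    (h : ∀ z₁ ∈ S, ∀ z₂ ∈ S, edist (V z₁) (V z₂) ≤
      K * ENNReal.ofReal ((dist z₁.2 z₂.2 + |z₁.1 - z₂.1| ^ (1 / 2 : ℝ)) ^ μ)) :
    HolderOnWith (K * ((Real.sqrt D + 1) ^ μ).toNNReal) (μ / 2).toNNReal V S := by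
  intro z₁ h₁ z₂ h₂
  refine (h z₁ h₁ z₂ h₂).trans ?_
  set d : ℝ := dist z₁ z₂ with hd
  have hd0 : 0 ≤ d := dist_nonneg
  have hx : dist z₁.2 z₂.2 ≤ d := by rw [hd, Prod.dist_eq]; exact le_max_right _ _
  have ht : |z₁.1 - z₂.1| ≤ d := by rw [hd, Prod.dist_eq, ← Real.dist_eq]; exact le_max_left _ _
  have hhalf : d ^ (1 / 2 : ℝ) * d ^ (1 / 2 : ℝ) = d := by
    rw [← Real.rpow_add' hd0 (by norm_num)]
    norm_num
  have hdD : d ^ (1 / 2 : ℝ) ≤ Real.sqrt D := by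
    rw [Real.sqrt_eq_rpow]
    exact Real.rpow_le_rpow hd0 (hdiam z₁ h₁ z₂ h₂) (by norm_num)
  have key1 : dist z₁.2 z₂.2 + |z₁.1 - z₂.1| ^ (1 / 2 : ℝ) ≤ (Real.sqrt D + 1) * d ^ (1 / 2 : ℝ) := by
    have hxx : dist z₁.2 z₂.2 ≤ Real.sqrt D * d ^ (1 / 2 : ℝ) := by
      refine hx.trans ?_
      calc d = d ^ (1 / 2 : ℝ) * d ^ (1 / 2 : ℝ) := hhalf.symm
        _ ≤ Real.sqrt D * d ^ (1 / 2 : ℝ) := mul_le_mul_of_nonneg_right hdD (by positivity)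
    have htt : |z₁.1 - z₂.1| ^ (1 / 2 : ℝ) ≤ d ^ (1 / 2 : ℝ) :=
      Real.rpow_le_rpow (abs_nonneg _) ht (by norm_num)
    linarith [add_mul (Real.sqrt D) 1 (d ^ (1 / 2 : ℝ))]
  have key : (dist z₁.2 z₂.2 + |z₁.1 - z₂.1| ^ (1 / 2 : ℝ)) ^ μ ≤
      (Real.sqrt D + 1) ^ μ * d ^ (μ / 2) := by
    calc (dist z₁.2 z₂.2 + |z₁.1 - z₂.1| ^ (1 / 2 : ℝ)) ^ μ
        ≤ ((Real.sqrt D + 1) * d ^ (1 / 2 : ℝ)) ^ μ := Real.rpow_le_rpow (by positivity) key1 hμ.le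
      _ = (Real.sqrt D + 1) ^ μ * (d ^ (1 / 2 : ℝ)) ^ μ := Real.mul_rpow (by positivity) (by positivity)
      _ = (Real.sqrt D + 1) ^ μ * d ^ (μ / 2) := by
          rw [← Real.rpow_mul hd0]
          congr 2
          ring
  have hL0 : 0 ≤ (Real.sqrt D + 1) ^ μ := by positivity
  have hcoe : ((((Real.sqrt D + 1) ^ μ).toNNReal : ℝ≥0) : ℝ≥0∞) =
      ENNReal.ofReal ((Real.sqrt D + 1) ^ μ) := rfl
  have hexp : (((μ / 2).toNNReal : ℝ≥0) : ℝ) = μ / 2 := Real.coe_toNNReal _ (by positivity)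
  rw [ENNReal.coe_mul, mul_assoc, hcoe, edist_dist, hexp,
    ENNReal.ofReal_rpow_of_nonneg dist_nonneg (by positivity), ← hd,
    ← ENNReal.ofReal_mul hL0]
  gcongr

end Tools2

end Literature.Analysis.FluidPDE
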